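import Literature.NumberTheory.Transcendental.L2HodgeTheoryLaplacianCounterexample
import Literature.Geometry.Kaehler.ManifoldFormsChart
import HarnessLib

/-!
# `H⁰ ⟂ δ(E¹)` (Warner, Thm. 6.8) fails on the non-compact real line: compactness is needed

Topic: the real `L²` Hodge theory of
`Literature/NumberTheory/Transcendental/L2HodgeTheory.lean`. The orthogonality `H^p ⟂ δ(E^{p+1})`
in the Hodge decomposition (F. W. Warner, *Foundations of Differentiable Manifolds and Lie
Groups*, GTM 94 (1983), Thm. 6.8, pp. 222–223) is proved in
`L2HodgeTheoryHarmonicCoexactProofs.lean` (`isL2Orthogonal_harmonicForms_coexact_of_isSmoothForm`)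
and vendored as the closed named fact `isL2Orthogonal_harmonicForms_coexact_of_closedManifold`
(`L2HodgeTheoryHarmonicCoexactFact.lean`) under Warner's standing hypothesis, p. 220:
"Throughout this chapter, `M` will be a compact oriented Riemannian manifold" — in Lean the
binders `[CompactSpace M] [I.Boundaryless]` and a continuous, `C^∞` fibre metric. This file shows
that the binder `[CompactSpace M]` cannot be dropped from that statement, all the others being
kept: on the flat real line of `L2HodgeTheoryLaplacianCounterexample.lean` (`namespace FlatLine`:
`M = ℝ`, boundaryless, `σ`-compact, Mathlib's smooth `riemannianMetricVectorSpace`, the constant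
orientation family `FlatLine.orient`, `Δf = -f''` on `0`-forms, and
`∫_ℝ c vol = sgn · e · ∫ c dλ_e` for compactly supported `c`, whichever partition of unity
`MForm.integral` chose) harmonic `0`-forms are **not** `L²`-orthogonal to `δ(E¹)`:

* `FlatLine.one_mem_harmonicForms`: the constant function `1` is a harmonic `0`-form (`Δ1 = -1'' = 0`).
* `FlatLine.zeroForm_φ_eq_mcoderiv`, `FlatLine.φ_mem_span_mcoderiv`: the bump `φ ≥ 0`, `φ(0) = 1`
  is **co-exact**, `φ = δ d(-g)` for the smooth, *not* compactly supported `g` with `g'' = φ`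
  (`δ d f = -f''` on the line) — exactly the boundary term at infinity that Warner's Prop. 6.2
  (Stokes) excludes by compactness: `⟨1, δγ⟩ = ⟨d1, γ⟩ + [γ]_{-∞}^{+∞}`.
* `FlatLine.l2Inner_one_φ_ne_zero`: `⟪1, φ⟫_{L²} = ∫_ℝ φ vol ≠ 0`
  (`FlatLine.integral_smul_vol_ne_zero`).
* `FlatLine.not_isL2Orthogonal_harmonicForms_coexact_real`:
  `¬ IsL2Orthogonal orient (harmonicForms orient _) (span (δ '' E¹(ℝ)))` in degree `k = 0`, and
  `not_forall_isL2Orthogonal_harmonicForms_coexact_real`: the statement of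
  `isL2Orthogonal_harmonicForms_coexact_of_closedManifold` with the single binder
  `[CompactSpace M]` deleted is false.

This complements `L2HodgeTheoryBoundaryCounterexamples.lean` (`GreenCounterexample`, the compact
manifold with boundary `[0, 1]`, where `1 = δ(-t dt)` is co-exact and harmonic with `⟪1, 1⟫ ≠ 0`):
there the hypothesis that fails is `I.Boundaryless`, here `M` is boundaryless but *not compact* —
both of Warner's standing hypotheses are needed.

History: this computation was first landed (2026-08-15) as the formal refutation of the named
fact `isL2Orthogonal_harmonicForms_coexact` of `L2HodgeTheory.lean`, a `def … : Prop` that had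
silently dropped the unused section instances `[CompactSpace M] [I.Boundaryless] …` it was
written under. Since the verdict clean-up of `L2HodgeTheory.lean` (2026-08-15) that `def` is a
deprecated record awaiting deletion, so the two final theorems are now stated directly in terms
of `IsL2Orthogonal`, `harmonicForms` and `mcoderiv` (definitionally what they stated before) and
no declaration of this file names the record any more. No definition, instance or notation is
introduced here.

## References

* F. W. Warner, *Foundations of Differentiable Manifolds and Lie Groups*, GTM 94, Springer
  (1983): p. 220 (standing hypotheses, 6.1), Prop. 6.2 (pp. 220–221), Def. 6.7 (p. 222),
  Thm. 6.8 (pp. 222–223).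
-/

noncomputable section

open scoped Manifold ContDiff Topology
open Bundle Module Set Function MeasureTheory ContinuousAlternatingMap
open Literature.Geometry.Kaehler

namespace Literature.NumberTheory.Transcendental

namespace FlatLine

attribute [local instance] factFinrank

/-- **The constant function `1` is a harmonic `0`-form on the flat real line** (`Δ1 = -1'' = 0`,
`FlatLine.hodgeLaplacian_zeroForm`), hence lies in `harmonicForms orient h` (degree pattern
`k = 0`, `m + 1 = 0 + 1` of the fact). Warner (1983), 6.1 (p. 220) and Def. 6.7 (p. 222).
[cite: WarnerGTM94, 6.1 and Def. 6.7] -/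
theorem one_mem_harmonicForms (h : 0 + (0 + 1) = 1) :
    zeroForm (fun _ ↦ (1 : ℝ)) ∈ (harmonicForms orient h : Set (MForm 𝓘(ℝ, ℝ) ℝ ℝ 0)) := by
  refine subset_harmonicForms orient h ⟨isSmoothForm_zeroForm contDiff_const, ?_⟩
  have e : hodgeLaplacian orient 0 (0 + 1) h (zeroForm fun _ ↦ (1 : ℝ)) =
      zeroForm (fun x ↦ -(deriv (deriv fun _ : ℝ ↦ (1 : ℝ)) x)) :=
    hodgeLaplacian_zeroForm (show 0 + 1 = 1 by rfl) _
  have h0 : (fun x : ℝ ↦ -(deriv (deriv fun _ : ℝ ↦ (1 : ℝ)) x)) = fun _ ↦ 0 := by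
    funext x; simp
  rw [e, h0, zeroForm_zero]

/-- **The bump `φ` is `δ d(-g)`** on the flat line: `δ d f = -f''`
(`FlatLine.mcoderiv_mextDeriv_zeroForm`) and `g'' = φ` (`FlatLine.deriv_deriv_g`), so
`δ d(-g) = -(-g)'' = φ`; here `-g` is smooth but not compactly supported. Warner (1983), 6.1,
p. 220 (`δ`, `Δ = δd` on functions). [cite: WarnerGTM94, 6.1, p. 220] -/
theorem zeroForm_φ_eq_mcoderiv (h' : (0 + 1) + 0 = 1) :
    zeroForm φ = mcoderiv orient h' (mextDeriv (zeroForm fun x ↦ -g x)) := by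
  rw [mcoderiv_mextDeriv_zeroForm h' (fun x ↦ -g x)]
  congr 1
  funext x
  have h1 : deriv (fun y ↦ -g y) = fun y ↦ -deriv g y := by
    funext y; exact deriv.fun_neg
  rw [h1, deriv.fun_neg, neg_neg, deriv_deriv_g]

/-- **`φ` is co-exact**: `zeroForm φ` lies in the span of `δ '' E¹(ℝ)`, witnessed by the smooth
`1`-form `d(-g)` (`isSmoothForm_mextDeriv`). [folklore] -/
theorem φ_mem_span_mcoderiv (h' : (0 + 1) + 0 = 1) :
    zeroForm φ ∈ (Submodule.span ℝ (mcoderiv orient h' ''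
      (smoothForms 𝓘(ℝ, ℝ) ℝ ℝ (0 + 1) : Set (MForm 𝓘(ℝ, ℝ) ℝ ℝ (0 + 1)))) : Set _) :=
  Submodule.subset_span ⟨mextDeriv (zeroForm fun x ↦ -g x),
    isSmoothForm_mextDeriv (inChart_mextDeriv_holds _ _ _) (isSmoothForm_zeroForm g_contDiff.neg),
    (zeroForm_φ_eq_mcoderiv h').symm⟩

/-- **`⟪1, φ⟫_{L²} ≠ 0`**: the `L²` integrand is `φ · vol` (`FlatLine.inner_zeroForm`), and a
nonnegative, somewhere positive, compactly supported continuous density has non-zero integral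
over the flat line (`FlatLine.integral_smul_vol_ne_zero`, valid for whichever partition of unity
`MForm.integral` chose). [folklore] -/
theorem l2Inner_one_φ_ne_zero :
    MForm.l2Inner orient (zeroForm fun _ ↦ (1 : ℝ)) (zeroForm φ) ≠ 0 := by
  have h2 : MForm.l2Inner orient (zeroForm fun _ ↦ (1 : ℝ)) (zeroForm φ) =
      MForm.integral orient (fun x ↦ φ x • riemannianVolumeForm orient x) := by
    unfold MForm.l2Inner
    congr 1
    funext x
    rw [inner_zeroForm, one_mul]
  rw [h2]
  exact integral_smul_vol_ne_zero φ.continuous φ.hasCompactSupport (fun x ↦ φ.nonneg) (x₀ := 0)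
    (by rw [φ.one_of_mem_closedBall (Metric.mem_closedBall_self φ.rIn_pos.le)]; exact one_ne_zero)

/-- **On the flat real line, harmonic `0`-forms are not `L²`-orthogonal to `δ(E¹)`.** For
`M = ℝ` (`𝓘(ℝ, ℝ)`, Mathlib's canonical smooth Riemannian structure, the constant orientation
family `FlatLine.orient`, `n = 1`, degrees `k = 0`, `m = 0`): `1 ∈ harmonicForms`
(`one_mem_harmonicForms`) and `φ ∈ span (δ '' E¹(ℝ))` (`φ_mem_span_mcoderiv`), yet
`⟪1, φ⟫_{L²} ≠ 0` (`l2Inner_one_φ_ne_zero`). So the conclusion of Warner (1983), Thm. 6.8,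
pp. 222–223 (`H^p ⟂ δ(E^{p+1})`) fails once his standing hypothesis "`M` compact" (p. 220) is
dropped, `M` being boundaryless with a smooth metric; the theorem under Warner's hypotheses is
`isL2Orthogonal_harmonicForms_coexact_of_isSmoothForm` (`L2HodgeTheoryHarmonicCoexactProofs.lean`).
[folklore] -/
theorem not_isL2Orthogonal_harmonicForms_coexact_real (h : 0 + (0 + 1) = 1) :
    ¬ IsL2Orthogonal orient (harmonicForms orient h : Set (MForm 𝓘(ℝ, ℝ) ℝ ℝ 0))
        (Submodule.span ℝ (mcoderiv orient (show (0 + 1) + 0 = 1 by omega) ''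
          (smoothForms 𝓘(ℝ, ℝ) ℝ ℝ (0 + 1) : Set (MForm 𝓘(ℝ, ℝ) ℝ ℝ (0 + 1))))) := by
  intro H
  exact l2Inner_one_φ_ne_zero (H _ (one_mem_harmonicForms h) _ (φ_mem_span_mcoderiv _))

end FlatLine

section UniversalClosure

attribute [local instance] FlatLine.factFinrank

/-- **Compactness cannot be dropped from `isL2Orthogonal_harmonicForms_coexact_of_closedManifold`.**
The statement of that closed named fact (`L2HodgeTheoryHarmonicCoexactFact.lean`: Warner (1983),
Thm. 6.8, `H^p ⟂ δ(E^{p+1})`, with his standing hypotheses bound inside) with the single binder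
`[CompactSpace M]` deleted — every other hypothesis kept: Hausdorff, `σ`-compact, `C^∞`,
boundaryless, continuous and `C^∞` fibre metric, smooth volume form — is false: it fails for the
flat real line (`FlatLine.not_isL2Orthogonal_harmonicForms_coexact_real`). (The failure on the
compact manifold with boundary `[0, 1]`, i.e. without `I.Boundaryless`, is in
`L2HodgeTheoryBoundaryCounterexamples.lean`.) [folklore] -/
theorem not_forall_isL2Orthogonal_harmonicForms_coexact_real :
    ¬ (∀ {E : Type} [NormedAddCommGroup E] [NormedSpace ℝ E] [FiniteDimensional ℝ E] {n : ℕ}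
        [Fact (finrank ℝ E = n)] [MeasurableSpace E] [BorelSpace E]
        {H : Type} [TopologicalSpace H] {I : ModelWithCorners ℝ E H}
        {M : Type} [TopologicalSpace M] [ChartedSpace H M] [T2Space M] [SigmaCompactSpace M]
        [IsManifold I ∞ M] [RiemannianBundle (fun x : M ↦ TangentSpace I x)]
        [I.Boundaryless] [IsContinuousRiemannianBundle E (fun x : M ↦ TangentSpace I x)]
        [IsContMDiffRiemannianBundle I ∞ E (fun x : M ↦ TangentSpace I x)] {k m : ℕ}
        (o : (x : M) → Orientation ℝ (TangentSpace I x) (Fin n)),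
        IsSmoothForm (riemannianVolumeForm o) → ∀ h : k + (m + 1) = n,
          IsL2Orthogonal o (harmonicForms o h : Set (MForm I M ℝ k))
            (Submodule.span ℝ (mcoderiv o (show (k + 1) + m = n by omega) ''
              (smoothForms I M ℝ (k + 1) : Set (MForm I M ℝ (k + 1)))))) :=
  fun H ↦
    -- Mathlib registers the flat metric of `ℝ` as `C^ω` (`IsContMDiffRiemannianBundle`, found by
    -- instance search) but not as an `IsContinuousRiemannianBundle`; supply that instance.
    haveI : IsContinuousRiemannianBundle ℝ (fun x : ℝ ↦ TangentSpace 𝓘(ℝ, ℝ) x) :=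
      ⟨(riemannianMetricVectorSpace ℝ).inner,
        (riemannianMetricVectorSpace ℝ).contMDiff.continuous, fun _ _ _ ↦ rfl⟩
    FlatLine.not_isL2Orthogonal_harmonicForms_coexact_real rfl
      (H FlatLine.orient FlatLine.isSmoothForm_riemannianVolumeForm rfl)

end UniversalClosure

end Literature.NumberTheory.Transcendental
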